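import Summits.QuantumFields.BalabanUV.Beta.GAN24.T2ShapeThreeOfF2a

/-!
# `BalabanUV.Beta.GAN24.W3ForcingOfZS` — binder row G-an2-4 / (CONV-C), W-slot road «W3» (gan24-p1-g5 `SKELETON-W3.md` v1.0.2 §8.3; ENDs
# `WSlotT2OfPieces` p213240): **ROW W3-F4b `hf` (THE FORCING RATE OF THE DIFFERENCE TOWER) AS A FUNCTION OF ROW W3-F2a (THE SOURCE ZERO
# MODES) AND THE PIN — `d = 3`, `Lc ≥ 2`, the END's LITERAL forcing at the tower of record `x := T♮`, `mom := fun _ ↦ 0`, EVERY input rate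
# `δin ≤ δf`** (G-an2-4 formalisation swarm, leaf prover 08 = the ROW W3-F4a∕F4b lineage, gen 20; journal INTENT «W3-F4B-OF-ZS*» l.10226;
# module name PROVISIONAL)

NOT IN PRINT; OUR PROOF ([folklore] composition BY NAME — zero analytic content is added in this file).  HONEST FRAMING (cell contract,
verbatim): «discharging `BetaPertH` makes Bałaban's UV stability UNCONDITIONAL — a real constructive-QFT result; it is NOT the continuum limit
and NOT the Clay problem.»  HONEST DEPENDENCY (verbatim): «continuum YM on T⁴ ⇐ BetaPertH ∧ nine spine estimates (0/9 proved); BetaPertH ⇐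
(D1) ∧ (D4) ∧ CAP+tail; G-an2-4 gates asym, D1 and NE2/3/4.»

WHY.  Referee ref2 R53-3 records ROW W3-F4b (`W3ForcingRate.forcing_locStencil₂_three` p212145 ∕ `W3SourceRowsEnd.hf_three` p214068) as «a
FUNCTION of «T2Shape»»: its only residual hypothesis beyond ROWS-MIX is the uniform shape `hx : ∀ j, LocStencil₂ (x j) C₂ δ₂` of the tower it is
evaluated on, and at the §8.3 instantiation `x := T♮` (an2's normalised Stage-B family) that is END #1's OUTPUT.  Leaf-12's
`T2ShapeThreeOfF2a.t2Shape_three_of_F2a(_symZ)` composes END #1 BY NAME from the landed rows F1a ∕ F3a ∕ F3b ∕ F4a (`mom := 0`, this lineage's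
`W3SourceRowsEnd.hb_three`) ∕ F4c and the K-slot, leaving EXACTLY ROW W3-F2a `hZ` and the pin.  Composing the two: ROW W3-F4b is a function of
ROW W3-F2a and the pin — the same standing as ROW W3-F2b (leaf-18's `WSlotForcingZeroModeW3.hZf_of_hZ_W3`), no longer of an OPEN END output.

WHAT (`d = 3`, `2 ≤ Lc`; `b♮_m` = leaf-04's bracket at the base-root border `vh₂S 3 Lc`; `f♮ m := (𝒜_{m+1} − 𝒜_m)[T♮_m] + (b♮_{m+1} − b♮_m)`
= END #2's literal forcing, `lin4` BY NAME, = the summand of leaf-01's F1b `T2UnitSplitShapes.unitS₂_T2Of_sub_eq_transport_add_sum_vh₂S_of_mix`):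
* §1 generic mixed table (`hmix : LocStencilFM Lc mixFF CM₂ δ₄`, `hδ₄`, `hfm`, `hm` = ROWS-MIX): **`hf_three_of_F2a_symZ`** (F2a as `∀ m, ZfreeSym (b♮_m)`:
  jointly `Lc`-covariant ∧ vanishing bond-SYMMETRISED ff charge), **`hf_three_of_F2a`** (F2a in the record `Zfree` of ref2 r57: covariant ∧ cell
  ff zero mode), **`hf_three_of_F2acell`** (F2a as the cell zero modes ALONE + the table covariance `hmixt`; the bracket's covariance conjunct is
  leaf-11's `T2OfBracketBlockCovariance.bracket_translate_block_base`), **`hf_three_of_F2asym`** (F2a as the bond-SYMMETRISED cell charges alone +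
  `hmixt` — the `ZfreeSym` currency of leaf-12-g21's THIRD REPAIR of the F4d ⊥, l.10219).  Conclusion (all three):
  `∃ Cf θ δf, 0 ≤ Cf ∧ 0 ≤ θ ∧ θ < 1 ∧ 0 < δf ∧ ∀ ⦃δin⦄, δin ≤ δf → ∀ m, LocStencil₂ (f♮ m) (Cf·θ^m) δin ∧ 0 ≤ Cf·θ^m` — for `δin ≤ δf` the inner
  statement IS END #2's binder `hf` at `mom := fun _ ↦ 0` (R57-2 (b); second conjunct by `rfl`), the rate to be chosen by END #3 AFTER END #1's
  output (R57-3 (w10′)).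
* §2 an1's mixed table `mixFF := mixFFAt (toSite r) Lc`, `r ∈ box (3+1) Lc` (ROWS-MIX discharged by `MixedJetTablesPlug.hmix_an1`,
  `WSlotMixedShape.mixFFAt_hfm`∕`mixFFAt_hm`): **`hf_three_an1_of_F2a`** — ⇐ pin ∧ F2a's cell zero modes only; **`hf_three_an1_of_F2asym`** — ⇐ pin ∧
  F2a's bond-symmetrised cell charges only.
PLUGS: `hx` := leaf-12's `t2Shape_three_of_F2a_symZ` ∕ `t2Shape_three_of_F2a` ∕ `t2Shape_three_an1_of_F2a(_symZ)`; then `W3SourceRowsEnd.hf_three`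
(K-slot `KSlotAssembly.convCKWall_holds`, S-slot `SpureUnitDrift.e3ShapeDrift_three`, engine `ValueReadoutLipschitz` ∕ `TransportStepLipschitz` inside).
HONEST: ROW W3-F2a (leaf-20, OPEN — delivered so far as a FUNCTION of leaf-06's channel bond sums) and the pin (an2's (P6), undischarged) remain
HYPOTHESES; asserts NO shape or rate of Bałaban's tables by itself; «T2Shape»∕«T2SupRate»∕«T2Drift» remain OPEN, NOT IN PRINT; discharges NOTHING
of (hW₂, hW₂all); wall binders: K 2∕2, S 2∕2 are tree theorems at d = 3, Lc ≥ 2, W 0∕2 (this module: reduction only); NOT «W-slot closed» — never under an undischarged pin; NEVER «G-an2-4 closed», NOT (CONV-C); NOT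
`BetaPertH`, NOT continuum, NOT Clay.  0 cited facts, 0 `def`, 0 `def … : Prop`, 0 sorry.
Unit `b2b-balaban-gan24-formalise-leaf-08` (G-an2-4 formalisation swarm, leaf prover 08, gen 20), 2026-08-20.
-/

noncomputable section

open Finset
open scoped BigOperators
open Literature.MathematicalPhysics.QuantumFieldTheory
open Literature.MathematicalPhysics.QuantumFieldTheory.Balaban1983to89
open Literature.MathematicalPhysics.QuantumFieldTheory.Balaban1983to89.Beta
open AffineAveraging (box toSite)
open ExpKernelCalculus (MKer shiftK)
open OneStepResolventKernel (Fib)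
open OneStepKernelFamily (KInvStep)
open StepJetData (mfNeg)
open SecondOrderResponse (W2SymOfK LocStencilFM)
open BalabanCompositeJets (LocStencil₂)
open BalabanStepJetsSucc (mmRead)
open BalabanStepW2 (K3OfK Spure M1 M2Of T2Of)
open AveragingMixedJetTables (vh₂S mixFFAt)
open Summit.QuantumFields.BalabanUV.Beta.HessKerDressedUnits (unitK unitS)
open Summit.QuantumFields.BalabanUV.Beta.SecondOrderUnits (unitM unitS₂ unitM₂)
open Summit.QuantumFields.BalabanUV.Beta.MixedJetTablesPlug (hmix_an1)
open Summit.QuantumFields.BalabanUV.Beta.GAN24.CombesThomas (sfStep smStep)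
open Summit.QuantumFields.BalabanUV.Beta.GAN24.StencilSlotOfE3 (one_le_of_two_le)
open Summit.QuantumFields.BalabanUV.Beta.GAN24.Push4Iter (BiTab)
open Summit.QuantumFields.BalabanUV.Beta.GAN24.BiStencilZeroMode (zmode)
open Summit.QuantumFields.BalabanUV.Beta.GAN24.T2RecursionAffine (lin4)
open Summit.QuantumFields.BalabanUV.Beta.GAN24.W3SourceRowsEnd (hf_three)
open Summit.QuantumFields.BalabanUV.Beta.GAN24.T2OfBracketBlockCovariance (bracket_translate_block_base)
open Summit.QuantumFields.BalabanUV.Beta.GAN24.WSlotMixedShape (mixFFAt_hfm mixFFAt_hm)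
open Summit.QuantumFields.BalabanUV.Beta.GAN24.T2ShapeThreeOfF2a (t2Shape_three_of_F2a_symZ t2Shape_three_of_F2a t2Shape_three_an1_of_F2a_symZ
  t2Shape_three_an1_of_F2a)

namespace Summit.QuantumFields.BalabanUV.Beta.GAN24.W3ForcingOfZS

/-! ## §1 Generic mixed table: ROW W3-F4b from ROW W3-F2a and the pin -/

section Three

variable {Lc : ℕ} [NeZero Lc]

/-- **ROW W3-F4b AS A FUNCTION OF ROW W3-F2a (`ZfreeSym` form) AND THE PIN**, `d = 3`, `Lc ≥ 2`, generic mixed table [folklore composition]: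
END #2's binder `hf` at `mom := fun _ ↦ 0` for EVERY input rate `δin ≤ δf` — `W3SourceRowsEnd.hf_three` with its tower-shape hypothesis `hx` («T2Shape»)
DISCHARGED by leaf-12's `T2ShapeThreeOfF2a.t2Shape_three_of_F2a_symZ` (END #1 composed by name).  Left: ROWS-MIX, the pin, ROW W3-F2a. -/
theorem hf_three_of_F2a_symZ (hLc : 2 ≤ Lc) (cE cVH cΛ cE₂ cB : ℝ) (Tc : Fin 4 → Fin 4 → Fin 4 → Fin 4 → ℝ)
    {mixFF : BiTab 3} {CM₂ δ₄ : ℝ} (hmix : LocStencilFM Lc mixFF CM₂ δ₄) (hδ₄ : 0 < δ₄)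
    (hfm : ∀ κ u ρ w x z (α μ' : Fin (3 + 1)), mixFF κ u ρ w x z (Sum.inl α) (Sum.inr μ') = 0)
    (hm : ∀ κ u ρ w x z (μ' : Fin (3 + 1)) (b : Fib 3), mixFF κ u ρ w x z (Sum.inr μ') b = 0)
    (hpin : |cE₂| ≤ (Lc : ℝ) ^ (2 * (3 + 1)))
    (hZ : ∀ m : ℕ, (∀ κ u κ' u' t, (fun κ u κ' u' =>
        (cE₂ * (Lc : ℝ) ^ (2 * (3 + 1))) •
            mmRead Lc (K3OfK (unitK (sfStep Lc m) (smStep 3 Lc m) (KInvStep (d := 3) Lc m)) Lc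
              (unitS (sfStep Lc m) (smStep 3 Lc m) (Spure 3 Lc cE cVH cΛ m)) (unitM (sfStep Lc m) (smStep 3 Lc m) (M1 3 Lc cΛ m))
              (W2SymOfK (unitK (sfStep Lc m) (smStep 3 Lc m) (KInvStep (d := 3) Lc m)) Lc
                (unitS (sfStep Lc m) (smStep 3 Lc m) (Spure 3 Lc cE cVH cΛ m)) (unitM (sfStep Lc m) (smStep 3 Lc m) (M1 3 Lc cΛ m)) 0
                (unitM₂ (sfStep Lc m) (smStep 3 Lc m) (M2Of 3 Lc mixFF m))) κ u κ' u')
          + cB • mfNeg ((vh₂S 3 Lc) κ u κ' u')) κ (u + (Lc : ℤ) • t) κ' (u' + (Lc : ℤ) • t) = shiftK (-((Lc : ℤ) • t)) ((fun κ u κ' u' =>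
        (cE₂ * (Lc : ℝ) ^ (2 * (3 + 1))) •
            mmRead Lc (K3OfK (unitK (sfStep Lc m) (smStep 3 Lc m) (KInvStep (d := 3) Lc m)) Lc
              (unitS (sfStep Lc m) (smStep 3 Lc m) (Spure 3 Lc cE cVH cΛ m)) (unitM (sfStep Lc m) (smStep 3 Lc m) (M1 3 Lc cΛ m))
              (W2SymOfK (unitK (sfStep Lc m) (smStep 3 Lc m) (KInvStep (d := 3) Lc m)) Lc
                (unitS (sfStep Lc m) (smStep 3 Lc m) (Spure 3 Lc cE cVH cΛ m)) (unitM (sfStep Lc m) (smStep 3 Lc m) (M1 3 Lc cΛ m)) 0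
                (unitM₂ (sfStep Lc m) (smStep 3 Lc m) (M2Of 3 Lc mixFF m))) κ u κ' u')
          + cB • mfNeg ((vh₂S 3 Lc) κ u κ' u')) κ u κ' u')) ∧
      (∀ κ κ' κ₁ κ₂, zmode Lc (fun κ u κ' u' =>
        (cE₂ * (Lc : ℝ) ^ (2 * (3 + 1))) •
            mmRead Lc (K3OfK (unitK (sfStep Lc m) (smStep 3 Lc m) (KInvStep (d := 3) Lc m)) Lc
              (unitS (sfStep Lc m) (smStep 3 Lc m) (Spure 3 Lc cE cVH cΛ m)) (unitM (sfStep Lc m) (smStep 3 Lc m) (M1 3 Lc cΛ m))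
              (W2SymOfK (unitK (sfStep Lc m) (smStep 3 Lc m) (KInvStep (d := 3) Lc m)) Lc
                (unitS (sfStep Lc m) (smStep 3 Lc m) (Spure 3 Lc cE cVH cΛ m)) (unitM (sfStep Lc m) (smStep 3 Lc m) (M1 3 Lc cΛ m)) 0
                (unitM₂ (sfStep Lc m) (smStep 3 Lc m) (M2Of 3 Lc mixFF m))) κ u κ' u')
          + cB • mfNeg ((vh₂S 3 Lc) κ u κ' u')) κ κ' (Sum.inl κ₁) (Sum.inl κ₂) + zmode Lc (fun κ u κ' u' =>
        (cE₂ * (Lc : ℝ) ^ (2 * (3 + 1))) •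
            mmRead Lc (K3OfK (unitK (sfStep Lc m) (smStep 3 Lc m) (KInvStep (d := 3) Lc m)) Lc
              (unitS (sfStep Lc m) (smStep 3 Lc m) (Spure 3 Lc cE cVH cΛ m)) (unitM (sfStep Lc m) (smStep 3 Lc m) (M1 3 Lc cΛ m))
              (W2SymOfK (unitK (sfStep Lc m) (smStep 3 Lc m) (KInvStep (d := 3) Lc m)) Lc
                (unitS (sfStep Lc m) (smStep 3 Lc m) (Spure 3 Lc cE cVH cΛ m)) (unitM (sfStep Lc m) (smStep 3 Lc m) (M1 3 Lc cΛ m)) 0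
                (unitM₂ (sfStep Lc m) (smStep 3 Lc m) (M2Of 3 Lc mixFF m))) κ u κ' u')
          + cB • mfNeg ((vh₂S 3 Lc) κ u κ' u')) κ' κ (Sum.inl κ₁) (Sum.inl κ₂) = 0)) :
    ∃ Cf θ δf : ℝ, 0 ≤ Cf ∧ 0 ≤ θ ∧ θ < 1 ∧ 0 < δf ∧ ∀ ⦃δin : ℝ⦄, δin ≤ δf → ∀ m, LocStencil₂
      (((lin4 (cE₂ * (Lc : ℝ) ^ (2 * (3 + 1))) (unitK (sfStep Lc (m + 1)) (smStep 3 Lc (m + 1)) (KInvStep (d := 3) Lc (m + 1))) Lc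
              (unitS₂ (sfStep Lc m) (smStep 3 Lc m) (T2Of 3 Lc cE cVH cΛ cE₂ cB Tc (vh₂S 3 Lc) mixFF m))
          - lin4 (cE₂ * (Lc : ℝ) ^ (2 * (3 + 1))) (unitK (sfStep Lc m) (smStep 3 Lc m) (KInvStep (d := 3) Lc m)) Lc
              (unitS₂ (sfStep Lc m) (smStep 3 Lc m) (T2Of 3 Lc cE cVH cΛ cE₂ cB Tc (vh₂S 3 Lc) mixFF m)))
        + ((fun κ u κ' u' =>
        (cE₂ * (Lc : ℝ) ^ (2 * (3 + 1))) •
            mmRead Lc (K3OfK (unitK (sfStep Lc (m + 1)) (smStep 3 Lc (m + 1)) (KInvStep (d := 3) Lc (m + 1))) Lc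
              (unitS (sfStep Lc (m + 1)) (smStep 3 Lc (m + 1)) (Spure 3 Lc cE cVH cΛ (m + 1))) (unitM (sfStep Lc (m + 1)) (smStep 3 Lc (m + 1)) (M1 3 Lc cΛ (m + 1)))
              (W2SymOfK (unitK (sfStep Lc (m + 1)) (smStep 3 Lc (m + 1)) (KInvStep (d := 3) Lc (m + 1))) Lc
                (unitS (sfStep Lc (m + 1)) (smStep 3 Lc (m + 1)) (Spure 3 Lc cE cVH cΛ (m + 1))) (unitM (sfStep Lc (m + 1)) (smStep 3 Lc (m + 1)) (M1 3 Lc cΛ (m + 1))) 0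
                (unitM₂ (sfStep Lc (m + 1)) (smStep 3 Lc (m + 1)) (M2Of 3 Lc mixFF (m + 1)))) κ u κ' u')
          + cB • mfNeg ((vh₂S 3 Lc) κ u κ' u'))
          - (fun κ u κ' u' =>
        (cE₂ * (Lc : ℝ) ^ (2 * (3 + 1))) •
            mmRead Lc (K3OfK (unitK (sfStep Lc m) (smStep 3 Lc m) (KInvStep (d := 3) Lc m)) Lc
              (unitS (sfStep Lc m) (smStep 3 Lc m) (Spure 3 Lc cE cVH cΛ m)) (unitM (sfStep Lc m) (smStep 3 Lc m) (M1 3 Lc cΛ m))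
              (W2SymOfK (unitK (sfStep Lc m) (smStep 3 Lc m) (KInvStep (d := 3) Lc m)) Lc
                (unitS (sfStep Lc m) (smStep 3 Lc m) (Spure 3 Lc cE cVH cΛ m)) (unitM (sfStep Lc m) (smStep 3 Lc m) (M1 3 Lc cΛ m)) 0
                (unitM₂ (sfStep Lc m) (smStep 3 Lc m) (M2Of 3 Lc mixFF m))) κ u κ' u')
          + cB • mfNeg ((vh₂S 3 Lc) κ u κ' u')))))
      (Cf * θ ^ m) δin ∧ 0 ≤ Cf * θ ^ m := by
  obtain ⟨C₂, δ₂, hδ₂, hx⟩ := t2Shape_three_of_F2a_symZ hLc cE cVH cΛ cE₂ cB Tc hmix hδ₄ hfm hm hpin hZ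
  exact hf_three hLc cE cVH cΛ cE₂ cB hmix hδ₄ hfm hm hx hδ₂

/-- **ROW W3-F4b AS A FUNCTION OF ROW W3-F2a's BOND-SYMMETRISED CELL CHARGES ALONE AND THE PIN** (`ZfreeSym` currency of leaf-12-g21's THIRD
REPAIR l.10219), `d = 3`, `Lc ≥ 2`, generic block-covariant mixed table (`hmixt`): the covariance conjunct of `ZfreeSym` for leaf-04's bracket is
leaf-11's `T2OfBracketBlockCovariance.bracket_translate_block_base` [folklore composition]. -/
theorem hf_three_of_F2asym (hLc : 2 ≤ Lc) (cE cVH cΛ cE₂ cB : ℝ) (Tc : Fin 4 → Fin 4 → Fin 4 → Fin 4 → ℝ)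
    {mixFF : BiTab 3} {CM₂ δ₄ : ℝ} (hmix : LocStencilFM Lc mixFF CM₂ δ₄) (hδ₄ : 0 < δ₄)
    (hfm : ∀ κ u ρ w x z (α μ' : Fin (3 + 1)), mixFF κ u ρ w x z (Sum.inl α) (Sum.inr μ') = 0)
    (hm : ∀ κ u ρ w x z (μ' : Fin (3 + 1)) (b : Fib 3), mixFF κ u ρ w x z (Sum.inr μ') b = 0)
    (hmixt : ∀ (κ : Fin (3 + 1)) (u : Fin (3 + 1) → ℤ) (ρ : Fin (3 + 1)) (w t : Fin (3 + 1) → ℤ),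
      mixFF κ (u + (Lc : ℤ) • t) ρ (w + t) = shiftK (-((Lc : ℤ) • t)) (mixFF κ u ρ w))
    (hpin : |cE₂| ≤ (Lc : ℝ) ^ (2 * (3 + 1)))
    (hZ : ∀ m : ℕ, (∀ κ κ' κ₁ κ₂, zmode Lc (fun κ u κ' u' =>
        (cE₂ * (Lc : ℝ) ^ (2 * (3 + 1))) •
            mmRead Lc (K3OfK (unitK (sfStep Lc m) (smStep 3 Lc m) (KInvStep (d := 3) Lc m)) Lc
              (unitS (sfStep Lc m) (smStep 3 Lc m) (Spure 3 Lc cE cVH cΛ m)) (unitM (sfStep Lc m) (smStep 3 Lc m) (M1 3 Lc cΛ m))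
              (W2SymOfK (unitK (sfStep Lc m) (smStep 3 Lc m) (KInvStep (d := 3) Lc m)) Lc
                (unitS (sfStep Lc m) (smStep 3 Lc m) (Spure 3 Lc cE cVH cΛ m)) (unitM (sfStep Lc m) (smStep 3 Lc m) (M1 3 Lc cΛ m)) 0
                (unitM₂ (sfStep Lc m) (smStep 3 Lc m) (M2Of 3 Lc mixFF m))) κ u κ' u')
          + cB • mfNeg ((vh₂S 3 Lc) κ u κ' u')) κ κ' (Sum.inl κ₁) (Sum.inl κ₂) + zmode Lc (fun κ u κ' u' =>
        (cE₂ * (Lc : ℝ) ^ (2 * (3 + 1))) •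
            mmRead Lc (K3OfK (unitK (sfStep Lc m) (smStep 3 Lc m) (KInvStep (d := 3) Lc m)) Lc
              (unitS (sfStep Lc m) (smStep 3 Lc m) (Spure 3 Lc cE cVH cΛ m)) (unitM (sfStep Lc m) (smStep 3 Lc m) (M1 3 Lc cΛ m))
              (W2SymOfK (unitK (sfStep Lc m) (smStep 3 Lc m) (KInvStep (d := 3) Lc m)) Lc
                (unitS (sfStep Lc m) (smStep 3 Lc m) (Spure 3 Lc cE cVH cΛ m)) (unitM (sfStep Lc m) (smStep 3 Lc m) (M1 3 Lc cΛ m)) 0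
                (unitM₂ (sfStep Lc m) (smStep 3 Lc m) (M2Of 3 Lc mixFF m))) κ u κ' u')
          + cB • mfNeg ((vh₂S 3 Lc) κ u κ' u')) κ' κ (Sum.inl κ₁) (Sum.inl κ₂) = 0)) :
    ∃ Cf θ δf : ℝ, 0 ≤ Cf ∧ 0 ≤ θ ∧ θ < 1 ∧ 0 < δf ∧ ∀ ⦃δin : ℝ⦄, δin ≤ δf → ∀ m, LocStencil₂
      (((lin4 (cE₂ * (Lc : ℝ) ^ (2 * (3 + 1))) (unitK (sfStep Lc (m + 1)) (smStep 3 Lc (m + 1)) (KInvStep (d := 3) Lc (m + 1))) Lc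
              (unitS₂ (sfStep Lc m) (smStep 3 Lc m) (T2Of 3 Lc cE cVH cΛ cE₂ cB Tc (vh₂S 3 Lc) mixFF m))
          - lin4 (cE₂ * (Lc : ℝ) ^ (2 * (3 + 1))) (unitK (sfStep Lc m) (smStep 3 Lc m) (KInvStep (d := 3) Lc m)) Lc
              (unitS₂ (sfStep Lc m) (smStep 3 Lc m) (T2Of 3 Lc cE cVH cΛ cE₂ cB Tc (vh₂S 3 Lc) mixFF m)))
        + ((fun κ u κ' u' =>
        (cE₂ * (Lc : ℝ) ^ (2 * (3 + 1))) •
            mmRead Lc (K3OfK (unitK (sfStep Lc (m + 1)) (smStep 3 Lc (m + 1)) (KInvStep (d := 3) Lc (m + 1))) Lc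
              (unitS (sfStep Lc (m + 1)) (smStep 3 Lc (m + 1)) (Spure 3 Lc cE cVH cΛ (m + 1))) (unitM (sfStep Lc (m + 1)) (smStep 3 Lc (m + 1)) (M1 3 Lc cΛ (m + 1)))
              (W2SymOfK (unitK (sfStep Lc (m + 1)) (smStep 3 Lc (m + 1)) (KInvStep (d := 3) Lc (m + 1))) Lc
                (unitS (sfStep Lc (m + 1)) (smStep 3 Lc (m + 1)) (Spure 3 Lc cE cVH cΛ (m + 1))) (unitM (sfStep Lc (m + 1)) (smStep 3 Lc (m + 1)) (M1 3 Lc cΛ (m + 1))) 0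
                (unitM₂ (sfStep Lc (m + 1)) (smStep 3 Lc (m + 1)) (M2Of 3 Lc mixFF (m + 1)))) κ u κ' u')
          + cB • mfNeg ((vh₂S 3 Lc) κ u κ' u'))
          - (fun κ u κ' u' =>
        (cE₂ * (Lc : ℝ) ^ (2 * (3 + 1))) •
            mmRead Lc (K3OfK (unitK (sfStep Lc m) (smStep 3 Lc m) (KInvStep (d := 3) Lc m)) Lc
              (unitS (sfStep Lc m) (smStep 3 Lc m) (Spure 3 Lc cE cVH cΛ m)) (unitM (sfStep Lc m) (smStep 3 Lc m) (M1 3 Lc cΛ m))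
              (W2SymOfK (unitK (sfStep Lc m) (smStep 3 Lc m) (KInvStep (d := 3) Lc m)) Lc
                (unitS (sfStep Lc m) (smStep 3 Lc m) (Spure 3 Lc cE cVH cΛ m)) (unitM (sfStep Lc m) (smStep 3 Lc m) (M1 3 Lc cΛ m)) 0
                (unitM₂ (sfStep Lc m) (smStep 3 Lc m) (M2Of 3 Lc mixFF m))) κ u κ' u')
          + cB • mfNeg ((vh₂S 3 Lc) κ u κ' u')))))
      (Cf * θ ^ m) δin ∧ 0 ≤ Cf * θ ^ m :=
  hf_three_of_F2a_symZ hLc cE cVH cΛ cE₂ cB Tc hmix hδ₄ hfm hm hpin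
    (fun m => ⟨fun κ u κ' u' t => bracket_translate_block_base (d := 3) (one_le_of_two_le hLc) cE cVH cΛ cE₂ cB hmixt m κ u κ' u' t, hZ m⟩)

/-- **ROW W3-F4b AS A FUNCTION OF ROW W3-F2a (record `Zfree` of ref2 r57: jointly `Lc`-covariant ∧ cell ff zero mode) AND THE PIN**, `d = 3`, `Lc ≥ 2`,
generic mixed table [folklore composition: `t2Shape_three_of_F2a` ⨾ `hf_three`]. -/
theorem hf_three_of_F2a (hLc : 2 ≤ Lc) (cE cVH cΛ cE₂ cB : ℝ) (Tc : Fin 4 → Fin 4 → Fin 4 → Fin 4 → ℝ)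
    {mixFF : BiTab 3} {CM₂ δ₄ : ℝ} (hmix : LocStencilFM Lc mixFF CM₂ δ₄) (hδ₄ : 0 < δ₄)
    (hfm : ∀ κ u ρ w x z (α μ' : Fin (3 + 1)), mixFF κ u ρ w x z (Sum.inl α) (Sum.inr μ') = 0)
    (hm : ∀ κ u ρ w x z (μ' : Fin (3 + 1)) (b : Fib 3), mixFF κ u ρ w x z (Sum.inr μ') b = 0)
    (hpin : |cE₂| ≤ (Lc : ℝ) ^ (2 * (3 + 1)))
    (hZ : ∀ m : ℕ, (∀ κ u κ' u' t, (fun κ u κ' u' =>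
        (cE₂ * (Lc : ℝ) ^ (2 * (3 + 1))) •
            mmRead Lc (K3OfK (unitK (sfStep Lc m) (smStep 3 Lc m) (KInvStep (d := 3) Lc m)) Lc
              (unitS (sfStep Lc m) (smStep 3 Lc m) (Spure 3 Lc cE cVH cΛ m)) (unitM (sfStep Lc m) (smStep 3 Lc m) (M1 3 Lc cΛ m))
              (W2SymOfK (unitK (sfStep Lc m) (smStep 3 Lc m) (KInvStep (d := 3) Lc m)) Lc
                (unitS (sfStep Lc m) (smStep 3 Lc m) (Spure 3 Lc cE cVH cΛ m)) (unitM (sfStep Lc m) (smStep 3 Lc m) (M1 3 Lc cΛ m)) 0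
                (unitM₂ (sfStep Lc m) (smStep 3 Lc m) (M2Of 3 Lc mixFF m))) κ u κ' u')
          + cB • mfNeg ((vh₂S 3 Lc) κ u κ' u')) κ (u + (Lc : ℤ) • t) κ' (u' + (Lc : ℤ) • t) = shiftK (-((Lc : ℤ) • t)) ((fun κ u κ' u' =>
        (cE₂ * (Lc : ℝ) ^ (2 * (3 + 1))) •
            mmRead Lc (K3OfK (unitK (sfStep Lc m) (smStep 3 Lc m) (KInvStep (d := 3) Lc m)) Lc
              (unitS (sfStep Lc m) (smStep 3 Lc m) (Spure 3 Lc cE cVH cΛ m)) (unitM (sfStep Lc m) (smStep 3 Lc m) (M1 3 Lc cΛ m))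
              (W2SymOfK (unitK (sfStep Lc m) (smStep 3 Lc m) (KInvStep (d := 3) Lc m)) Lc
                (unitS (sfStep Lc m) (smStep 3 Lc m) (Spure 3 Lc cE cVH cΛ m)) (unitM (sfStep Lc m) (smStep 3 Lc m) (M1 3 Lc cΛ m)) 0
                (unitM₂ (sfStep Lc m) (smStep 3 Lc m) (M2Of 3 Lc mixFF m))) κ u κ' u')
          + cB • mfNeg ((vh₂S 3 Lc) κ u κ' u')) κ u κ' u')) ∧
      (∀ κ κ' κ₁ κ₂, zmode Lc (fun κ u κ' u' =>
        (cE₂ * (Lc : ℝ) ^ (2 * (3 + 1))) •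
            mmRead Lc (K3OfK (unitK (sfStep Lc m) (smStep 3 Lc m) (KInvStep (d := 3) Lc m)) Lc
              (unitS (sfStep Lc m) (smStep 3 Lc m) (Spure 3 Lc cE cVH cΛ m)) (unitM (sfStep Lc m) (smStep 3 Lc m) (M1 3 Lc cΛ m))
              (W2SymOfK (unitK (sfStep Lc m) (smStep 3 Lc m) (KInvStep (d := 3) Lc m)) Lc
                (unitS (sfStep Lc m) (smStep 3 Lc m) (Spure 3 Lc cE cVH cΛ m)) (unitM (sfStep Lc m) (smStep 3 Lc m) (M1 3 Lc cΛ m)) 0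
                (unitM₂ (sfStep Lc m) (smStep 3 Lc m) (M2Of 3 Lc mixFF m))) κ u κ' u')
          + cB • mfNeg ((vh₂S 3 Lc) κ u κ' u')) κ κ' (Sum.inl κ₁) (Sum.inl κ₂) = 0)) :
    ∃ Cf θ δf : ℝ, 0 ≤ Cf ∧ 0 ≤ θ ∧ θ < 1 ∧ 0 < δf ∧ ∀ ⦃δin : ℝ⦄, δin ≤ δf → ∀ m, LocStencil₂
      (((lin4 (cE₂ * (Lc : ℝ) ^ (2 * (3 + 1))) (unitK (sfStep Lc (m + 1)) (smStep 3 Lc (m + 1)) (KInvStep (d := 3) Lc (m + 1))) Lc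
              (unitS₂ (sfStep Lc m) (smStep 3 Lc m) (T2Of 3 Lc cE cVH cΛ cE₂ cB Tc (vh₂S 3 Lc) mixFF m))
          - lin4 (cE₂ * (Lc : ℝ) ^ (2 * (3 + 1))) (unitK (sfStep Lc m) (smStep 3 Lc m) (KInvStep (d := 3) Lc m)) Lc
              (unitS₂ (sfStep Lc m) (smStep 3 Lc m) (T2Of 3 Lc cE cVH cΛ cE₂ cB Tc (vh₂S 3 Lc) mixFF m)))
        + ((fun κ u κ' u' =>
        (cE₂ * (Lc : ℝ) ^ (2 * (3 + 1))) •
            mmRead Lc (K3OfK (unitK (sfStep Lc (m + 1)) (smStep 3 Lc (m + 1)) (KInvStep (d := 3) Lc (m + 1))) Lc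
              (unitS (sfStep Lc (m + 1)) (smStep 3 Lc (m + 1)) (Spure 3 Lc cE cVH cΛ (m + 1))) (unitM (sfStep Lc (m + 1)) (smStep 3 Lc (m + 1)) (M1 3 Lc cΛ (m + 1)))
              (W2SymOfK (unitK (sfStep Lc (m + 1)) (smStep 3 Lc (m + 1)) (KInvStep (d := 3) Lc (m + 1))) Lc
                (unitS (sfStep Lc (m + 1)) (smStep 3 Lc (m + 1)) (Spure 3 Lc cE cVH cΛ (m + 1))) (unitM (sfStep Lc (m + 1)) (smStep 3 Lc (m + 1)) (M1 3 Lc cΛ (m + 1))) 0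
                (unitM₂ (sfStep Lc (m + 1)) (smStep 3 Lc (m + 1)) (M2Of 3 Lc mixFF (m + 1)))) κ u κ' u')
          + cB • mfNeg ((vh₂S 3 Lc) κ u κ' u'))
          - (fun κ u κ' u' =>
        (cE₂ * (Lc : ℝ) ^ (2 * (3 + 1))) •
            mmRead Lc (K3OfK (unitK (sfStep Lc m) (smStep 3 Lc m) (KInvStep (d := 3) Lc m)) Lc
              (unitS (sfStep Lc m) (smStep 3 Lc m) (Spure 3 Lc cE cVH cΛ m)) (unitM (sfStep Lc m) (smStep 3 Lc m) (M1 3 Lc cΛ m))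
              (W2SymOfK (unitK (sfStep Lc m) (smStep 3 Lc m) (KInvStep (d := 3) Lc m)) Lc
                (unitS (sfStep Lc m) (smStep 3 Lc m) (Spure 3 Lc cE cVH cΛ m)) (unitM (sfStep Lc m) (smStep 3 Lc m) (M1 3 Lc cΛ m)) 0
                (unitM₂ (sfStep Lc m) (smStep 3 Lc m) (M2Of 3 Lc mixFF m))) κ u κ' u')
          + cB • mfNeg ((vh₂S 3 Lc) κ u κ' u')))))
      (Cf * θ ^ m) δin ∧ 0 ≤ Cf * θ ^ m := by
  obtain ⟨C₂, δ₂, hδ₂, hx⟩ := t2Shape_three_of_F2a hLc cE cVH cΛ cE₂ cB Tc hmix hδ₄ hfm hm hpin hZ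
  exact hf_three hLc cE cVH cΛ cE₂ cB hmix hδ₄ hfm hm hx hδ₂

/-- **ROW W3-F4b AS A FUNCTION OF ROW W3-F2a's CELL ZERO MODES ALONE AND THE PIN**, `d = 3`, `Lc ≥ 2`, generic mixed table that is jointly
block-covariant (`hmixt`, an2's binder): the covariance conjunct of the record `Zfree` for leaf-04's bracket is leaf-11's tree theorem
`T2OfBracketBlockCovariance.bracket_translate_block_base` [folklore composition]. -/
theorem hf_three_of_F2acell (hLc : 2 ≤ Lc) (cE cVH cΛ cE₂ cB : ℝ) (Tc : Fin 4 → Fin 4 → Fin 4 → Fin 4 → ℝ)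
    {mixFF : BiTab 3} {CM₂ δ₄ : ℝ} (hmix : LocStencilFM Lc mixFF CM₂ δ₄) (hδ₄ : 0 < δ₄)
    (hfm : ∀ κ u ρ w x z (α μ' : Fin (3 + 1)), mixFF κ u ρ w x z (Sum.inl α) (Sum.inr μ') = 0)
    (hm : ∀ κ u ρ w x z (μ' : Fin (3 + 1)) (b : Fib 3), mixFF κ u ρ w x z (Sum.inr μ') b = 0)
    (hmixt : ∀ (κ : Fin (3 + 1)) (u : Fin (3 + 1) → ℤ) (ρ : Fin (3 + 1)) (w t : Fin (3 + 1) → ℤ),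
      mixFF κ (u + (Lc : ℤ) • t) ρ (w + t) = shiftK (-((Lc : ℤ) • t)) (mixFF κ u ρ w))
    (hpin : |cE₂| ≤ (Lc : ℝ) ^ (2 * (3 + 1)))
    (hZ : ∀ m : ℕ, (∀ κ κ' κ₁ κ₂, zmode Lc (fun κ u κ' u' =>
        (cE₂ * (Lc : ℝ) ^ (2 * (3 + 1))) •
            mmRead Lc (K3OfK (unitK (sfStep Lc m) (smStep 3 Lc m) (KInvStep (d := 3) Lc m)) Lc
              (unitS (sfStep Lc m) (smStep 3 Lc m) (Spure 3 Lc cE cVH cΛ m)) (unitM (sfStep Lc m) (smStep 3 Lc m) (M1 3 Lc cΛ m))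
              (W2SymOfK (unitK (sfStep Lc m) (smStep 3 Lc m) (KInvStep (d := 3) Lc m)) Lc
                (unitS (sfStep Lc m) (smStep 3 Lc m) (Spure 3 Lc cE cVH cΛ m)) (unitM (sfStep Lc m) (smStep 3 Lc m) (M1 3 Lc cΛ m)) 0
                (unitM₂ (sfStep Lc m) (smStep 3 Lc m) (M2Of 3 Lc mixFF m))) κ u κ' u')
          + cB • mfNeg ((vh₂S 3 Lc) κ u κ' u')) κ κ' (Sum.inl κ₁) (Sum.inl κ₂) = 0)) :
    ∃ Cf θ δf : ℝ, 0 ≤ Cf ∧ 0 ≤ θ ∧ θ < 1 ∧ 0 < δf ∧ ∀ ⦃δin : ℝ⦄, δin ≤ δf → ∀ m, LocStencil₂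
      (((lin4 (cE₂ * (Lc : ℝ) ^ (2 * (3 + 1))) (unitK (sfStep Lc (m + 1)) (smStep 3 Lc (m + 1)) (KInvStep (d := 3) Lc (m + 1))) Lc
              (unitS₂ (sfStep Lc m) (smStep 3 Lc m) (T2Of 3 Lc cE cVH cΛ cE₂ cB Tc (vh₂S 3 Lc) mixFF m))
          - lin4 (cE₂ * (Lc : ℝ) ^ (2 * (3 + 1))) (unitK (sfStep Lc m) (smStep 3 Lc m) (KInvStep (d := 3) Lc m)) Lc
              (unitS₂ (sfStep Lc m) (smStep 3 Lc m) (T2Of 3 Lc cE cVH cΛ cE₂ cB Tc (vh₂S 3 Lc) mixFF m)))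
        + ((fun κ u κ' u' =>
        (cE₂ * (Lc : ℝ) ^ (2 * (3 + 1))) •
            mmRead Lc (K3OfK (unitK (sfStep Lc (m + 1)) (smStep 3 Lc (m + 1)) (KInvStep (d := 3) Lc (m + 1))) Lc
              (unitS (sfStep Lc (m + 1)) (smStep 3 Lc (m + 1)) (Spure 3 Lc cE cVH cΛ (m + 1))) (unitM (sfStep Lc (m + 1)) (smStep 3 Lc (m + 1)) (M1 3 Lc cΛ (m + 1)))
              (W2SymOfK (unitK (sfStep Lc (m + 1)) (smStep 3 Lc (m + 1)) (KInvStep (d := 3) Lc (m + 1))) Lc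
                (unitS (sfStep Lc (m + 1)) (smStep 3 Lc (m + 1)) (Spure 3 Lc cE cVH cΛ (m + 1))) (unitM (sfStep Lc (m + 1)) (smStep 3 Lc (m + 1)) (M1 3 Lc cΛ (m + 1))) 0
                (unitM₂ (sfStep Lc (m + 1)) (smStep 3 Lc (m + 1)) (M2Of 3 Lc mixFF (m + 1)))) κ u κ' u')
          + cB • mfNeg ((vh₂S 3 Lc) κ u κ' u'))
          - (fun κ u κ' u' =>
        (cE₂ * (Lc : ℝ) ^ (2 * (3 + 1))) •
            mmRead Lc (K3OfK (unitK (sfStep Lc m) (smStep 3 Lc m) (KInvStep (d := 3) Lc m)) Lc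
              (unitS (sfStep Lc m) (smStep 3 Lc m) (Spure 3 Lc cE cVH cΛ m)) (unitM (sfStep Lc m) (smStep 3 Lc m) (M1 3 Lc cΛ m))
              (W2SymOfK (unitK (sfStep Lc m) (smStep 3 Lc m) (KInvStep (d := 3) Lc m)) Lc
                (unitS (sfStep Lc m) (smStep 3 Lc m) (Spure 3 Lc cE cVH cΛ m)) (unitM (sfStep Lc m) (smStep 3 Lc m) (M1 3 Lc cΛ m)) 0
                (unitM₂ (sfStep Lc m) (smStep 3 Lc m) (M2Of 3 Lc mixFF m))) κ u κ' u')
          + cB • mfNeg ((vh₂S 3 Lc) κ u κ' u')))))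
      (Cf * θ ^ m) δin ∧ 0 ≤ Cf * θ ^ m :=
  hf_three_of_F2a hLc cE cVH cΛ cE₂ cB Tc hmix hδ₄ hfm hm hpin
    (fun m => ⟨fun κ u κ' u' t => bracket_translate_block_base (d := 3) (one_le_of_two_le hLc) cE cVH cΛ cE₂ cB hmixt m κ u κ' u' t, hZ m⟩)

end Three

/-! ## §2 an1's mixed table at a box root -/

section An1

variable {Lc : ℕ} [NeZero Lc] {r : Fin (3 + 1) → ℕ}

/-- **ROW W3-F4b FOR an1's MIXED TABLE `mixFFAt (toSite r) Lc` (`r ∈ box (3+1) Lc`) AS A FUNCTION OF ROW W3-F2a's CELL ZERO MODES AND THE PIN**,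
`d = 3`, `Lc ≥ 2` [folklore composition]: ROWS-MIX by `MixedJetTablesPlug.hmix_an1` ∕ `WSlotMixedShape.mixFFAt_hfm` ∕ `mixFFAt_hm`, «T2Shape» by
leaf-12's `t2Shape_three_an1_of_F2a`, then `W3SourceRowsEnd.hf_three`. -/
theorem hf_three_an1_of_F2a (hLc : 2 ≤ Lc) (hr : r ∈ box (3 + 1) Lc) (cE cVH cΛ cE₂ cB : ℝ) (Tc : Fin 4 → Fin 4 → Fin 4 → Fin 4 → ℝ)
    (hpin : |cE₂| ≤ (Lc : ℝ) ^ (2 * (3 + 1)))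
    (hZ : ∀ m : ℕ, (∀ κ κ' κ₁ κ₂, zmode Lc (fun κ u κ' u' =>
        (cE₂ * (Lc : ℝ) ^ (2 * (3 + 1))) •
            mmRead Lc (K3OfK (unitK (sfStep Lc m) (smStep 3 Lc m) (KInvStep (d := 3) Lc m)) Lc
              (unitS (sfStep Lc m) (smStep 3 Lc m) (Spure 3 Lc cE cVH cΛ m)) (unitM (sfStep Lc m) (smStep 3 Lc m) (M1 3 Lc cΛ m))
              (W2SymOfK (unitK (sfStep Lc m) (smStep 3 Lc m) (KInvStep (d := 3) Lc m)) Lc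
                (unitS (sfStep Lc m) (smStep 3 Lc m) (Spure 3 Lc cE cVH cΛ m)) (unitM (sfStep Lc m) (smStep 3 Lc m) (M1 3 Lc cΛ m)) 0
                (unitM₂ (sfStep Lc m) (smStep 3 Lc m) (M2Of 3 Lc (mixFFAt (toSite r) Lc) m))) κ u κ' u')
          + cB • mfNeg ((vh₂S 3 Lc) κ u κ' u')) κ κ' (Sum.inl κ₁) (Sum.inl κ₂) = 0)) :
    ∃ Cf θ δf : ℝ, 0 ≤ Cf ∧ 0 ≤ θ ∧ θ < 1 ∧ 0 < δf ∧ ∀ ⦃δin : ℝ⦄, δin ≤ δf → ∀ m, LocStencil₂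
      (((lin4 (cE₂ * (Lc : ℝ) ^ (2 * (3 + 1))) (unitK (sfStep Lc (m + 1)) (smStep 3 Lc (m + 1)) (KInvStep (d := 3) Lc (m + 1))) Lc
              (unitS₂ (sfStep Lc m) (smStep 3 Lc m) (T2Of 3 Lc cE cVH cΛ cE₂ cB Tc (vh₂S 3 Lc) (mixFFAt (toSite r) Lc) m))
          - lin4 (cE₂ * (Lc : ℝ) ^ (2 * (3 + 1))) (unitK (sfStep Lc m) (smStep 3 Lc m) (KInvStep (d := 3) Lc m)) Lc
              (unitS₂ (sfStep Lc m) (smStep 3 Lc m) (T2Of 3 Lc cE cVH cΛ cE₂ cB Tc (vh₂S 3 Lc) (mixFFAt (toSite r) Lc) m)))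
        + ((fun κ u κ' u' =>
        (cE₂ * (Lc : ℝ) ^ (2 * (3 + 1))) •
            mmRead Lc (K3OfK (unitK (sfStep Lc (m + 1)) (smStep 3 Lc (m + 1)) (KInvStep (d := 3) Lc (m + 1))) Lc
              (unitS (sfStep Lc (m + 1)) (smStep 3 Lc (m + 1)) (Spure 3 Lc cE cVH cΛ (m + 1))) (unitM (sfStep Lc (m + 1)) (smStep 3 Lc (m + 1)) (M1 3 Lc cΛ (m + 1)))
              (W2SymOfK (unitK (sfStep Lc (m + 1)) (smStep 3 Lc (m + 1)) (KInvStep (d := 3) Lc (m + 1))) Lc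
                (unitS (sfStep Lc (m + 1)) (smStep 3 Lc (m + 1)) (Spure 3 Lc cE cVH cΛ (m + 1))) (unitM (sfStep Lc (m + 1)) (smStep 3 Lc (m + 1)) (M1 3 Lc cΛ (m + 1))) 0
                (unitM₂ (sfStep Lc (m + 1)) (smStep 3 Lc (m + 1)) (M2Of 3 Lc (mixFFAt (toSite r) Lc) (m + 1)))) κ u κ' u')
          + cB • mfNeg ((vh₂S 3 Lc) κ u κ' u'))
          - (fun κ u κ' u' =>
        (cE₂ * (Lc : ℝ) ^ (2 * (3 + 1))) •
            mmRead Lc (K3OfK (unitK (sfStep Lc m) (smStep 3 Lc m) (KInvStep (d := 3) Lc m)) Lc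
              (unitS (sfStep Lc m) (smStep 3 Lc m) (Spure 3 Lc cE cVH cΛ m)) (unitM (sfStep Lc m) (smStep 3 Lc m) (M1 3 Lc cΛ m))
              (W2SymOfK (unitK (sfStep Lc m) (smStep 3 Lc m) (KInvStep (d := 3) Lc m)) Lc
                (unitS (sfStep Lc m) (smStep 3 Lc m) (Spure 3 Lc cE cVH cΛ m)) (unitM (sfStep Lc m) (smStep 3 Lc m) (M1 3 Lc cΛ m)) 0
                (unitM₂ (sfStep Lc m) (smStep 3 Lc m) (M2Of 3 Lc (mixFFAt (toSite r) Lc) m))) κ u κ' u')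
          + cB • mfNeg ((vh₂S 3 Lc) κ u κ' u')))))
      (Cf * θ ^ m) δin ∧ 0 ≤ Cf * θ ^ m := by
  obtain ⟨CM₂, δ₄, hδ₄, hmix⟩ := hmix_an1 (d := 3) (Lc := Lc) (one_le_of_two_le hLc) hr
  obtain ⟨C₂, δ₂, hδ₂, hx⟩ := t2Shape_three_an1_of_F2a hLc hr cE cVH cΛ cE₂ cB Tc hpin hZ
  exact hf_three hLc cE cVH cΛ cE₂ cB hmix hδ₄ (mixFFAt_hfm _) (mixFFAt_hm _) hx hδ₂

/-- **ROW W3-F4b FOR an1's MIXED TABLE AS A FUNCTION OF ROW W3-F2a's BOND-SYMMETRISED CELL CHARGES AND THE PIN** (`ZfreeSym` currency), `d = 3`,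
`Lc ≥ 2`, `r ∈ box (3+1) Lc` [folklore composition: leaf-12's `t2Shape_three_an1_of_F2a_symZ` ⨾ `W3SourceRowsEnd.hf_three`]. -/
theorem hf_three_an1_of_F2asym (hLc : 2 ≤ Lc) (hr : r ∈ box (3 + 1) Lc) (cE cVH cΛ cE₂ cB : ℝ) (Tc : Fin 4 → Fin 4 → Fin 4 → Fin 4 → ℝ)
    (hpin : |cE₂| ≤ (Lc : ℝ) ^ (2 * (3 + 1)))
    (hZ : ∀ m : ℕ, (∀ κ κ' κ₁ κ₂, zmode Lc (fun κ u κ' u' =>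
        (cE₂ * (Lc : ℝ) ^ (2 * (3 + 1))) •
            mmRead Lc (K3OfK (unitK (sfStep Lc m) (smStep 3 Lc m) (KInvStep (d := 3) Lc m)) Lc
              (unitS (sfStep Lc m) (smStep 3 Lc m) (Spure 3 Lc cE cVH cΛ m)) (unitM (sfStep Lc m) (smStep 3 Lc m) (M1 3 Lc cΛ m))
              (W2SymOfK (unitK (sfStep Lc m) (smStep 3 Lc m) (KInvStep (d := 3) Lc m)) Lc
                (unitS (sfStep Lc m) (smStep 3 Lc m) (Spure 3 Lc cE cVH cΛ m)) (unitM (sfStep Lc m) (smStep 3 Lc m) (M1 3 Lc cΛ m)) 0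
                (unitM₂ (sfStep Lc m) (smStep 3 Lc m) (M2Of 3 Lc (mixFFAt (toSite r) Lc) m))) κ u κ' u')
          + cB • mfNeg ((vh₂S 3 Lc) κ u κ' u')) κ κ' (Sum.inl κ₁) (Sum.inl κ₂) + zmode Lc (fun κ u κ' u' =>
        (cE₂ * (Lc : ℝ) ^ (2 * (3 + 1))) •
            mmRead Lc (K3OfK (unitK (sfStep Lc m) (smStep 3 Lc m) (KInvStep (d := 3) Lc m)) Lc
              (unitS (sfStep Lc m) (smStep 3 Lc m) (Spure 3 Lc cE cVH cΛ m)) (unitM (sfStep Lc m) (smStep 3 Lc m) (M1 3 Lc cΛ m))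
              (W2SymOfK (unitK (sfStep Lc m) (smStep 3 Lc m) (KInvStep (d := 3) Lc m)) Lc
                (unitS (sfStep Lc m) (smStep 3 Lc m) (Spure 3 Lc cE cVH cΛ m)) (unitM (sfStep Lc m) (smStep 3 Lc m) (M1 3 Lc cΛ m)) 0
                (unitM₂ (sfStep Lc m) (smStep 3 Lc m) (M2Of 3 Lc (mixFFAt (toSite r) Lc) m))) κ u κ' u')
          + cB • mfNeg ((vh₂S 3 Lc) κ u κ' u')) κ' κ (Sum.inl κ₁) (Sum.inl κ₂) = 0)) :
    ∃ Cf θ δf : ℝ, 0 ≤ Cf ∧ 0 ≤ θ ∧ θ < 1 ∧ 0 < δf ∧ ∀ ⦃δin : ℝ⦄, δin ≤ δf → ∀ m, LocStencil₂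
      (((lin4 (cE₂ * (Lc : ℝ) ^ (2 * (3 + 1))) (unitK (sfStep Lc (m + 1)) (smStep 3 Lc (m + 1)) (KInvStep (d := 3) Lc (m + 1))) Lc
              (unitS₂ (sfStep Lc m) (smStep 3 Lc m) (T2Of 3 Lc cE cVH cΛ cE₂ cB Tc (vh₂S 3 Lc) (mixFFAt (toSite r) Lc) m))
          - lin4 (cE₂ * (Lc : ℝ) ^ (2 * (3 + 1))) (unitK (sfStep Lc m) (smStep 3 Lc m) (KInvStep (d := 3) Lc m)) Lc
              (unitS₂ (sfStep Lc m) (smStep 3 Lc m) (T2Of 3 Lc cE cVH cΛ cE₂ cB Tc (vh₂S 3 Lc) (mixFFAt (toSite r) Lc) m)))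
        + ((fun κ u κ' u' =>
        (cE₂ * (Lc : ℝ) ^ (2 * (3 + 1))) •
            mmRead Lc (K3OfK (unitK (sfStep Lc (m + 1)) (smStep 3 Lc (m + 1)) (KInvStep (d := 3) Lc (m + 1))) Lc
              (unitS (sfStep Lc (m + 1)) (smStep 3 Lc (m + 1)) (Spure 3 Lc cE cVH cΛ (m + 1))) (unitM (sfStep Lc (m + 1)) (smStep 3 Lc (m + 1)) (M1 3 Lc cΛ (m + 1)))
              (W2SymOfK (unitK (sfStep Lc (m + 1)) (smStep 3 Lc (m + 1)) (KInvStep (d := 3) Lc (m + 1))) Lc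
                (unitS (sfStep Lc (m + 1)) (smStep 3 Lc (m + 1)) (Spure 3 Lc cE cVH cΛ (m + 1))) (unitM (sfStep Lc (m + 1)) (smStep 3 Lc (m + 1)) (M1 3 Lc cΛ (m + 1))) 0
                (unitM₂ (sfStep Lc (m + 1)) (smStep 3 Lc (m + 1)) (M2Of 3 Lc (mixFFAt (toSite r) Lc) (m + 1)))) κ u κ' u')
          + cB • mfNeg ((vh₂S 3 Lc) κ u κ' u'))
          - (fun κ u κ' u' =>
        (cE₂ * (Lc : ℝ) ^ (2 * (3 + 1))) •
            mmRead Lc (K3OfK (unitK (sfStep Lc m) (smStep 3 Lc m) (KInvStep (d := 3) Lc m)) Lc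
              (unitS (sfStep Lc m) (smStep 3 Lc m) (Spure 3 Lc cE cVH cΛ m)) (unitM (sfStep Lc m) (smStep 3 Lc m) (M1 3 Lc cΛ m))
              (W2SymOfK (unitK (sfStep Lc m) (smStep 3 Lc m) (KInvStep (d := 3) Lc m)) Lc
                (unitS (sfStep Lc m) (smStep 3 Lc m) (Spure 3 Lc cE cVH cΛ m)) (unitM (sfStep Lc m) (smStep 3 Lc m) (M1 3 Lc cΛ m)) 0
                (unitM₂ (sfStep Lc m) (smStep 3 Lc m) (M2Of 3 Lc (mixFFAt (toSite r) Lc) m))) κ u κ' u')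
          + cB • mfNeg ((vh₂S 3 Lc) κ u κ' u')))))
      (Cf * θ ^ m) δin ∧ 0 ≤ Cf * θ ^ m := by
  obtain ⟨CM₂, δ₄, hδ₄, hmix⟩ := hmix_an1 (d := 3) (Lc := Lc) (one_le_of_two_le hLc) hr
  obtain ⟨C₂, δ₂, hδ₂, hx⟩ := t2Shape_three_an1_of_F2a_symZ hLc hr cE cVH cΛ cE₂ cB Tc hpin hZ
  exact hf_three hLc cE cVH cΛ cE₂ cB hmix hδ₄ (mixFFAt_hfm _) (mixFFAt_hm _) hx hδ₂

end An1

end Summit.QuantumFields.BalabanUV.Beta.GAN24.W3ForcingOfZS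

end
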